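import Summits.ResolutionOfSingularities.ResolutionOfSingularities.Theorems.FrobeniusClosingPatchingRelPerfectMonomialSupPow
import Summits.ResolutionOfSingularities.ResolutionOfSingularities.Theorems.FrobeniusClosingPatchingRelPerfectMonomialPairContraction
import HarnessLib

/-!
# Crux `PatchingRelPerfect` (stmt-ResolutionOfSingularities-16161), chain w52 — R4ˢ END-GAME, every depth `ℓ`,
# in the COMPANION FORMAT: `I𝒪_X = M · (monomialIdeal A ⊔ 𝓘_E^ℓ)` ⇒ `I ∈ 𝒞`

[OURS · L1 W5.2 · R4ˢ-pure END-GAME/M2 → M3 → D5, one call] Composition of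
`exists_centreSeq_principalize_sup_pow` (…MonomialSupPow.lean) with Stacks 080B along the tower
(`centreSeq_exists_isBlowup_comp_supported`) and D5 (`towerContraction` / `atomConclusion_of_tower`,
p493249): for `g : X → Spec S` a blowing up cosupported in the closed point of the regular local `S`,
`I ≠ 0`, `I𝒪_X = M · (monomialIdeal A ⊔ E^ℓ)` with `M` locally principal, `A` an exponent list on a simple
normal crossings boundary of `X` containing `E`, and `V(monomialIdeal A ⊔ E^ℓ)` over the closed point (e.g.
`E` the exceptional hypersurface of maximal contact), SOME `Bl_{I·Q} S`, `Q ⊇ 𝔪^m`, is regular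
(`companion_of_sup_pow`) and the core's conclusion holds for every blowing up along `I`
(`atomConclusion_of_sup_pow`).  Fact-free, any dimension of `S`; FORMAT evidence in the sense of CHAIN
§1 (A); nothing here is a statement of the manuscript under review.

## References

* The Stacks Project, Tags 080A, 080B. [StacksProject]
* J. Kollár, *Lectures on Resolution of Singularities* (2007), (3.111) Step 3. [Kollar2007]
-/

-- `Summit.<Summit>.<Sub>.Theorems` with `Sub = Summit` (single-conjunct summit, D-0017)
set_option linter.dupNamespace false

noncomputable section

open CategoryTheory AlgebraicGeometry TopologicalSpace IsLocalRing
open Literature.AlgebraicGeometry.Resolution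

namespace Summit.ResolutionOfSingularities.ResolutionOfSingularities.Theorems

namespace MonomialCleanup

universe u

/-- **END-GAME in the companion format, every depth `ℓ`.** `S` regular local, `I ≠ 0`; `g : X → Spec S`
a blowing up cosupported in the closed point, `X` Noetherian; `I𝒪_X = M · (monomialIdeal A ⊔ E^ℓ)` with `M`
locally principal, `A` an exponent list on an snc boundary of `X` containing `E`, and the cosupport of
`monomialIdeal A ⊔ E^ℓ` over the closed point.  Then some `Bl_{I·Q} S` with `Q ⊇ 𝔪^m` is regular.
[cite: StacksProject, Tag 080A] [cite: Kollar2007, (3.111) Step 3] -/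
theorem companion_of_sup_pow {S : Type u} [CommRing S] [IsRegularLocalRing S] {I : Ideal S}
    (hI : I ≠ ⊥) {X : Scheme.{u}} [IsNoetherian X] {g : X ⟶ Spec (.of S)}
    {K₀ : (Spec (.of S)).IdealSheafData} (hg : IsBlowup g K₀)
    (hK₀ : (K₀.support : Set (Spec (.of S))) ⊆ {IsLocalRing.closedPoint S})
    (A : List (X.IdealSheafData × ℕ)) (hA : HasSNC (boundaryOf A)) {E : X.IdealSheafData}
    (hE : E ∈ boundaryOf A) (ℓ : ℕ) {M : X.IdealSheafData} (hM : IsLocallyPrincipal M)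
    (hfmt : (affineBlowup.idealSheaf I).comap g = M * (monomialIdeal A ⊔ E ^ ℓ))
    (hsupp : ((monomialIdeal A ⊔ E ^ ℓ).support : Set X) ⊆ g ⁻¹' {IsLocalRing.closedPoint S}) :
    ∃ (Q : Ideal S) (m : ℕ), IsLocalRing.maximalIdeal S ^ m ≤ Q ∧
      ∃ (B : Scheme.{u}) (b : B ⟶ Spec (.of S)),
        IsBlowup b (affineBlowup.idealSheaf (I * Q)) ∧ Scheme.IsRegular B := by
  obtain ⟨s, -, hover, hreg, hlp⟩ := exists_centreSeq_principalize_sup_pow A hA hE ℓ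
  obtain ⟨Q, hQ, hQT⟩ := centreSeq_exists_isBlowup_comp_supported s g {IsLocalRing.closedPoint S}
    ⟨K₀, hg, hK₀⟩ (CentreSeq.CentresOver.mono s hsupp hover)
  refine towerContraction I hI s.top (s.comp ≫ g) Q hQ hQT hreg ?_
  rw [Scheme.IdealSheafData.comap_comp, hfmt, comap_mul]
  exact (hM.comap s.comp).mul hlp

/-- **The core's conclusion from the END-GAME format, every depth `ℓ`**: under the hypotheses of
`companion_of_sup_pow`, every blowing up `T → Spec S` along `I` carries a non-zero ideal sheaf
cosupported in the closed fibre whose blowing up is regular. [cite: StacksProject, Tag 080A] -/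
theorem atomConclusion_of_sup_pow {S : Type u} [CommRing S] [IsRegularLocalRing S] {I : Ideal S}
    (hI : I ≠ ⊥) {X : Scheme.{u}} [IsNoetherian X] {g : X ⟶ Spec (.of S)}
    {K₀ : (Spec (.of S)).IdealSheafData} (hg : IsBlowup g K₀)
    (hK₀ : (K₀.support : Set (Spec (.of S))) ⊆ {IsLocalRing.closedPoint S})
    (A : List (X.IdealSheafData × ℕ)) (hA : HasSNC (boundaryOf A)) {E : X.IdealSheafData}
    (hE : E ∈ boundaryOf A) (ℓ : ℕ) {M : X.IdealSheafData} (hM : IsLocallyPrincipal M)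
    (hfmt : (affineBlowup.idealSheaf I).comap g = M * (monomialIdeal A ⊔ E ^ ℓ))
    (hsupp : ((monomialIdeal A ⊔ E ^ ℓ).support : Set X) ⊆ g ⁻¹' {IsLocalRing.closedPoint S})
    (T : Scheme.{u}) (f : T ⟶ Spec (.of S)) (hf : IsBlowup f (affineBlowup.idealSheaf I)) :
    ∃ (J : T.IdealSheafData) (T' : Scheme.{u}) (π : T' ⟶ T), J ≠ ⊥ ∧
      (∀ t : T, t ∈ J.support → f.base t = IsLocalRing.closedPoint S) ∧
      IsBlowup π J ∧ Scheme.IsRegular T' := by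
  obtain ⟨s, -, hover, hreg, hlp⟩ := exists_centreSeq_principalize_sup_pow A hA hE ℓ
  obtain ⟨Q, hQ, hQT⟩ := centreSeq_exists_isBlowup_comp_supported s g {IsLocalRing.closedPoint S}
    ⟨K₀, hg, hK₀⟩ (CentreSeq.CentresOver.mono s hsupp hover)
  refine atomConclusion_of_tower hI hQ hQT hreg ?_ T f hf
  rw [Scheme.IdealSheafData.comap_comp, hfmt, comap_mul]
  exact (hM.comap s.comp).mul hlp

end MonomialCleanup

end Summit.ResolutionOfSingularities.ResolutionOfSingularities.Theorems

end
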